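import Summits.ABC.IUTFork.Cor312LicenceExactOrdersM
import HarnessLib

/-!
# [IUTchIII] Cor. 3.12, Step (xi-f): at SINGLETON fibres (one member of `V̲` over the rational prime — e.g. `F_mod = ℚ`) the
# licence at the M-LEVEL setting of record is DECIDED EXACTLY by the integer orders predicate, per packet and globally

PROOF-ONLY record file (D-0012; no definitions, no `Prop` facts, no instances) of the abc-iut cell (WAVE-5 prover seat
abc-iut-w5-d166, gen 7; D-0079 R-W lane U, row «W:M-U2-ORDERS», part 2 of 3 over `Cor312LicenceExactOrdersM` (p466948)).
TAKES NO SIDE on [IUTchIII] Cor. 3.12 (S. Mochizuki, *Inter-universal Teichmüller theory III*, kurims manuscript, Cor. 3.12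
p. 173 l. 41 – p. 174 l. 19; Step (xi-f) p. 184 l. 26–29) or on any author.

THE POINT. Part 1 proved the NECESSITY of abc-iut-w5-d180's orders predicate at every member `x₀` of a fibre of `V̲` and recorded why
the converse is out of reach at MIXED summands (non-conjugate completions: `min_J d_{L_J}` unknown). When the fibre of `V̲` over `u`
has ONE member `x₀` — the case of every datum whose field of moduli has a single place over `p_u`, in particular `F_mod = ℚ`
(rational `j`-invariant: the Frey / known-abc-triple rows of the R-W WINDOW-TABLE) — EVERY summand `v⃗ : S^±_{j+1} → V̲_u` is the
diagonal one `(x₀,…,x₀)`, abc-iut-w6-d018's `d_I − min_J d_{L_J} = j·d_{K_{x₀}}` is exact, and the converse holds: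

* §2 **`qRegion_subset_thetaHull_settingPrVolSharpM_iff_orders_of_forall_eq`** — `∀ x, x = x₀` over `u`; uniformiser `ϖ` of
  `K_{x₀}`, `d = D/e`, inner/outer radii `‖cin₀‖ = ‖ϖ‖^{R_in}`, `‖cout₀‖ = ‖ϖ‖^{R_out}` (abc-iut-c312-5's binders), `‖t_{Θ,j,x₀}‖ = ‖ϖ‖^M`,
  `‖t_{q,x₀}‖ = ‖ϖ‖^{m_q}`: **`qRegion (j,u) ⊆ ⁿ˒°𝒰_{j,u} ⟺ e·((M − j·D − (j+1)·R_in) / e) + (j+1)·R_out ≤ m_q`** — ANY local type;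
* §3 **`licence_settingPrVolSharpM_iff_orders_of_forall_eq`** — all fibres singletons (`x₀ : ∀ u, V̲_u`), witnesses per `u`, exponents
  `M(u,i)`, `m_q(u)`: **`Licence ⟺ ∀ u i, e_u·((M(u,i) − (i+1)·D_u − (i+2)·R_in(u)) / e_u) + (i+2)·R_out(u) ≤ m_q(u)`** (archimedean
  packets automatic, p459449 `qRegion_subset_thetaHull_settingPrVolSharpM_arc`); `orders_predicate_of_exponents_zero` records that
  the predicate is AUTOMATIC where both ideles are units (`M = m_q = 0`: `R_out ≤ R_in`, `D ≥ 0`), so only the bad members are tests.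

This is the M-setting analogue of the K line's exact window decisions (abc-iut-w4-d036 `licence_settingPrVolSharp_iff_shellRadii`,
abc-iut-w5-d180 `iota_smul_subset_packetHull_orbit_iota_smul_iff_orders`, abc-iut-w5-d009 `licence_settingPrVolSharp_pilotDataOfK_iff_of_tame`):
at singleton-fibre data BOTH verdicts (refuted / inhabited) of an M row are kernel statements about OUR typed licence.
HONEST SCOPE: the singleton hypothesis is the consumer's input (nothing about which data satisfy it is claimed here); the licence is a
STRONGER-THAN-PRINT set-level reading of Step (xi-f) (ADJUDICATION-SPEC §2 (G1′)); OUR sharp containers (Θ-regions constant in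
`m`) and typed (Ind1)/(Ind2)/(Ind3); inhabited-as-typed ≠ true-in-print, refuted-as-typed ≠ refuted-in-print; nothing here bears on
the printed GLOBAL inequality or the NUMBER-level `Cor22.Cor312AtDatum`; no side taken. [cite: Mochizuki2012, IUTchIII Cor. 3.12
p. 173–174, Step (xi) p. 183–184; Thm. 3.11 (i) (Ind1)(Ind2) p. 154; IUTchIV Prop. 1.1 p. 9, Prop. 1.2 (i)(ii) p. 10; IUTchI Def. 3.1
(b)(e) p. 61–62] [cite: DupuyHilado2025, §3.4, §3.9, §4.9, §4.12] [cite: NeukirchANT1999, Ch. II (5.5)] [claim: Mochizuki2012, status: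
disputed] for every IUT sentence quoted. typed ≠ proved (these: proved); instantiated ≠ endorsed.
-/

noncomputable section

open Set Function NumberField IsDedekindDomain
open scoped Pointwise

namespace Summit.ABC.IUTFork.Thm311.Real

open Cor312 Cor312Vol Literature.IUT.LogThetaLattice Literature.IUT.LogVolume Literature.IUT.HodgeTheaters
  Literature.NumberTheory.NumberFields Literature.NumberTheory.GaloisRepresentations.Ultrametric

/-! ## §1. The predicate is automatic where both ideles are units -/

/-- **Unit ideles satisfy the orders predicate**: for `e > 0`, `R_out ≤ R_in` (the outer radius of a lattice is at least its
inner radius) and `D ≥ 0`, the predicate at `M = m_q = 0` reads `e·((−j·D − (j+1)·R_in)/e) + (j+1)·R_out ≤ 0`, which holds since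
`e·(x / e) ≤ x`. So at singleton-fibre data only the members carrying non-unit ideles are genuine tests. [folklore] -/
theorem orders_predicate_of_exponents_zero {e : ℤ} (he : 0 < e) {Dx Rin Rout : ℤ} (hD : 0 ≤ Dx) (hR : Rout ≤ Rin) (j : ℕ) :
    e * ((0 - (j : ℤ) * Dx - ((j : ℤ) + 1) * Rin) / e) + ((j : ℤ) + 1) * Rout ≤ 0 := by
  have h1 : e * ((0 - (j : ℤ) * Dx - ((j : ℤ) + 1) * Rin) / e) ≤ 0 - (j : ℤ) * Dx - ((j : ℤ) + 1) * Rin :=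
    Int.mul_ediv_self_le he.ne'
  have h2 : (0 : ℤ) ≤ (j : ℤ) * Dx := mul_nonneg (by positivity) hD
  nlinarith

variable {F K Fbar : Type} [Field F] [NumberField F] [Field K] [NumberField K] [Algebra F K]
  [Field Fbar] [Algebra F Fbar] [Algebra K Fbar] {E : WeierstrassCurve F} [E.IsElliptic] {l : ℕ}
  {Pb : BadPlacePredicates K} (D : InitialThetaData F K Fbar E l Pb) {logvK : PadicLogsVal K}
  (hlog : LogvAnalyticVal logvK)
  (t : ∀ (u : FinitePlace ℚ) (_ : Fin (thetaIndexOfInitial D).lstar) (x : (thetaIndexOfInitial D).Fibre (Val.non u)),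
    kOfM D (ratChar u) u (natCast_ratChar_mem u) x)
  (tq : ∀ (u : FinitePlace ℚ) (x : (thetaIndexOfInitial D).Fibre (Val.non u)),
    kOfM D (ratChar u) u (natCast_ratChar_mem u) x)
  (M : Type) [Field M] [NumberField M]
  (archPk : ∀ (j : (thetaIndexOfInitial D).Label) (vQ : (thetaIndexOfInitial D).VQ),
    Set ((logShellsOfInitialDH D logvK).Packet j vQ))
  (archSub : ∀ (j : (thetaIndexOfInitial D).Label) (v : (thetaIndexOfInitial D).V),
    Set ((logShellsOfInitialDH D logvK).Packet j ((thetaIndexOfInitial D).over v)))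
  (Ψ : ℤ → ∀ v : (thetaIndexOfInitial D).V, v ∈ (thetaIndexOfInitial D).Vbad →
    Set ((logShellsOfInitialDH D logvK).StarPacket v))
  (act : ℤ → ∀ v : (thetaIndexOfInitial D).V, v ∈ (thetaIndexOfInitial D).Vbad →
    (logShellsOfInitialDH D logvK).StarPacket v → Module.End ℚ ((logShellsOfInitialDH D logvK).StarPacket v))
  (Mmod : ℤ → ∀ j : (thetaIndexOfInitial D).LabelStar, Set ((logShellsOfInitialDH D logvK).GlobalPacket j.1))
  (region : ℤ → ∀ j : (thetaIndexOfInitial D).LabelStar, FinDivisor M → ∀ vQ : (thetaIndexOfInitial D).VQ,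
    Set ((logShellsOfInitialDH D logvK).Packet j.1 vQ))
  (n : ℤ) {HT : Type} {LogLink : HT → HT → Type} {IsFull : ∀ {s t : HT}, LogLink s t → Prop}
  (lat : LGPGaussianLogThetaLattice LogLink IsFull)
  {Frd : Type} {IsoF : Frd → Frd → Type} {Ob : Frd → Type} {realify : Frd → Frd} {Strip : Type}
  {IsoS : Strip → Strip → Type}
  {Mv : ∀ v : (thetaIndexOfInitial D).V, v ∈ (thetaIndexOfInitial D).Vbad → Type} [∀ v h, Monoid (Mv v h)]
  (sig : GlobalLGPFrobenioidSignature (thetaIndexOfInitial D).lstar (thetaIndexOfInitial D).V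
    (· ∈ (thetaIndexOfInitial D).Vbad) Frd IsoF Ob realify Strip IsoS Mv)
  (split : SplittingMonoids Mv) {ObΔ : Type}
  {N : ∀ v : (thetaIndexOfInitial D).V, v ∈ (thetaIndexOfInitial D).Vbad → Type} [∀ v h, Monoid (N v h)]
  (qData : QPilotData ObΔ N)
  (htq0 : ∀ u x, tq u x ≠ 0) (Sq : Finset (FinitePlace ℚ))
  (htq1 : ∀ (u : FinitePlace ℚ) (x : (thetaIndexOfInitial D).Fibre (Val.non u)), u ∉ Sq → ‖tq u x‖ = 1)

/-- `R_out ≤ R_in` for radius witnesses in abc-iut-c312-5's convention at a genuine carrier `K_{x₀}`: `cin₀ = cin₀·1 ∈ log_p(𝒪^×)`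
has norm at most the largest norm `‖cout₀‖`, and `‖ϖ‖ < 1`. [cite: NeukirchANT1999, Ch. II (5.5)] -/
theorem radius_exponent_le_of_witnesses (u : FinitePlace ℚ) (x₀ : (thetaIndexOfInitial D).Fibre (Val.non u))
    {ϖ : (kOfM D (ratChar u) u (natCast_ratChar_mem u) x₀)ˣ} (hϖ : IsUniformizer ϖ)
    {cin₀ cout₀ : kOfM D (ratChar u) u (natCast_ratChar_mem u) x₀}
    (hin : ∀ o : kOfM D (ratChar u) u (natCast_ratChar_mem u) x₀, ‖o‖ ≤ 1 →
      cin₀ * o ∈ logUnits (kOfM D (ratChar u) u (natCast_ratChar_mem u) x₀))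
    (hdom : ∀ z ∈ logUnits (kOfM D (ratChar u) u (natCast_ratChar_mem u) x₀), ‖z‖ ≤ ‖cout₀‖) {Rin Rout : ℤ}
    (hRin : ‖cin₀‖ = ‖(ϖ : kOfM D (ratChar u) u (natCast_ratChar_mem u) x₀)‖ ^ Rin)
    (hRout : ‖cout₀‖ = ‖(ϖ : kOfM D (ratChar u) u (natCast_ratChar_mem u) x₀)‖ ^ Rout) : Rout ≤ Rin := by
  have h := hdom _ (by simpa using hin 1 (by simp))
  rw [hRin, hRout] at h
  exact (zpow_le_zpow_iff_right_of_lt_one₀ (norm_pos_iff.2 ϖ.ne_zero) hϖ.1).mp h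

/-! ## §2. One member over `u`: the packet inclusion is the orders predicate, EXACTLY -/

/-- **SINGLETON FIBRE: `qRegion (j,u) ⊆ ⁿ˒°𝒰_{j,u}` ⟺ THE ORDERS PREDICATE AT THE UNIQUE MEMBER.** Non-zero Θ-ideles; every
member of the fibre of `V̲` over `u` equals `x₀` (e.g. `F_mod` has one place over `p_u`); a norm uniformiser `ϖ` of `K_{x₀}` with
`d_{K_{x₀}} = D/e`; inner/outer radius witnesses `cin₀`/`cout₀` of `log_p(𝒪^×_{K_{x₀}})` with `‖cin₀‖ = ‖ϖ‖^{R_in}`, `‖cout₀‖ = ‖ϖ‖^{R_out}`;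
`‖t_{Θ,j,x₀}‖ = ‖ϖ‖^M`, `‖t_{q,x₀}‖ = ‖ϖ‖^{m_q}`. THEN the packet clause of the licence at `(j,u)` holds **iff**
`e·((M − j·D − (j+1)·R_in) / e) + (j+1)·R_out ≤ m_q`. (→) is part 1; (←): every summand is the diagonal one, whose exact cell is
abc-iut-c312-5's `iota_smul_normalizedPacket_subset_zpow_smul_logPacket_iff` with `d_I − min_J d_{L_J} = j·d_{K_{x₀}}`
(`dSum_sub_inf_differentOrd_dFac_const`), through this lineage's content-free criterion `qRegion_subset_thetaHull_settingPrVolSharpM_iff`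
(p459449). [cite: Mochizuki2012, IUTchIII Cor. 3.12 Step (xi-f) p. 184; IUTchIV Prop. 1.1 p. 9, Prop. 1.2 (i)(ii) p. 10]
[cite: DupuyHilado2025, §3.9, §4.9, §4.12] [cite: NeukirchANT1999, Ch. II (5.5)] -/
theorem qRegion_subset_thetaHull_settingPrVolSharpM_iff_orders_of_forall_eq (ht0 : ∀ u i x, t u i x ≠ 0)
    (j : (thetaIndexOfInitial D).Label) (u : FinitePlace ℚ) (x₀ : (thetaIndexOfInitial D).Fibre (Val.non u))
    (hx : ∀ x : (thetaIndexOfInitial D).Fibre (Val.non u), x = x₀)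
    {ϖ : (kOfM D (ratChar u) u (natCast_ratChar_mem u) x₀)ˣ} (hϖ : IsUniformizer ϖ) {Dx : ℕ}
    (hD : differentOrd (ratChar u) (kOfM D (ratChar u) u (natCast_ratChar_mem u) x₀) =
      (Dx : ℝ) / absRamificationIdx (ratChar u) (kOfM D (ratChar u) u (natCast_ratChar_mem u) x₀))
    {cin₀ cout₀ : kOfM D (ratChar u) u (natCast_ratChar_mem u) x₀}
    (hin : ∀ o : kOfM D (ratChar u) u (natCast_ratChar_mem u) x₀, ‖o‖ ≤ 1 →
      cin₀ * o ∈ logUnits (kOfM D (ratChar u) u (natCast_ratChar_mem u) x₀))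
    (hmax : ∃ (ϖ' : (kOfM D (ratChar u) u (natCast_ratChar_mem u) x₀)ˣ) (w : kOfM D (ratChar u) u (natCast_ratChar_mem u) x₀),
      IsUniformizer ϖ' ∧ w ∉ logUnits (kOfM D (ratChar u) u (natCast_ratChar_mem u) x₀) ∧
        ‖w‖ * ‖(ϖ' : kOfM D (ratChar u) u (natCast_ratChar_mem u) x₀)‖ ≤ ‖cin₀‖)
    (houtΛ : cout₀ ∈ logUnits (kOfM D (ratChar u) u (natCast_ratChar_mem u) x₀))
    (hdom : ∀ z ∈ logUnits (kOfM D (ratChar u) u (natCast_ratChar_mem u) x₀), ‖z‖ ≤ ‖cout₀‖)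
    {Rin Rout Mx mq : ℤ} (hRin : ‖cin₀‖ = ‖(ϖ : kOfM D (ratChar u) u (natCast_ratChar_mem u) x₀)‖ ^ Rin)
    (hRout : ‖cout₀‖ = ‖(ϖ : kOfM D (ratChar u) u (natCast_ratChar_mem u) x₀)‖ ^ Rout)
    (hΘ : ‖(presAtM D hlog u).labelIdele (t u) j x₀‖ = ‖(ϖ : kOfM D (ratChar u) u (natCast_ratChar_mem u) x₀)‖ ^ Mx)
    (hq : ‖tq u x₀‖ = ‖(ϖ : kOfM D (ratChar u) u (natCast_ratChar_mem u) x₀)‖ ^ mq) :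
    (settingPrVolSharpM D hlog t tq M archPk archSub Ψ act Mmod region n lat sig split qData htq0 Sq htq1).qRegion j
        (Val.non u) ⊆
      (settingPrVolSharpM D hlog t tq M archPk archSub Ψ act Mmod region n lat sig split qData htq0 Sq htq1).thetaHull j (Val.non u) ↔
    (absRamificationIdx (ratChar u) (kOfM D (ratChar u) u (natCast_ratChar_mem u) x₀) : ℤ) *
        ((Mx - ((j : ℕ) : ℤ) * (Dx : ℤ) - (((j : ℕ) : ℤ) + 1) * Rin) /
          (absRamificationIdx (ratChar u) (kOfM D (ratChar u) u (natCast_ratChar_mem u) x₀) : ℤ)) +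
      (((j : ℕ) : ℤ) + 1) * Rout ≤ mq := by
  refine ⟨orders_of_qRegion_subset_thetaHull_settingPrVolSharpM D hlog t tq M archPk archSub Ψ act Mmod region n lat sig split
    qData htq0 Sq htq1 ht0 j u x₀ hϖ hD hin hmax houtΛ hdom hRin hRout hΘ hq, fun hpred => ?_⟩
  classical
  haveI : Nonempty ((thetaIndexOfInitial D).Caps j) := ⟨0⟩
  set e : ℕ := absRamificationIdx (ratChar u) (kOfM D (ratChar u) u (natCast_ratChar_mem u) x₀) with he_def
  have he0 : (0 : ℤ) < (e : ℤ) := by exact_mod_cast absRamificationIdx_pos (ratChar u) _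
  have hϖ0 : 0 < ‖(ϖ : kOfM D (ratChar u) u (natCast_ratChar_mem u) x₀)‖ := norm_pos_iff.2 ϖ.ne_zero
  have hin0 : cin₀ ≠ 0 := by
    rw [← norm_pos_iff, hRin]; exact zpow_pos hϖ0 _
  -- outer radii at every member: chosen elements of largest norm (at `x₀` their norm IS `‖cout₀‖`)
  have hex : ∀ x : (thetaIndexOfInitial D).Fibre (Val.non u),
      ∃ z ∈ logUnits (kOfM D (ratChar u) u (natCast_ratChar_mem u) x),
        ∀ w ∈ logUnits (kOfM D (ratChar u) u (natCast_ratChar_mem u) x), ‖w‖ ≤ ‖z‖ :=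
    fun x => exists_norm_isMaxOn_logUnits (ratChar u) (kOfM D (ratChar u) u (natCast_ratChar_mem u) x)
  choose z hz hzmax using hex
  have hz0 : ‖z x₀‖ = ‖cout₀‖ := le_antisymm (hdom _ (hz x₀)) (hzmax x₀ _ houtΛ)
  refine (qRegion_subset_thetaHull_settingPrVolSharpM_iff D hlog t tq M archPk archSub Ψ act Mmod region n lat sig split qData htq0
    Sq htq1 ht0 j u z hz hzmax).mpr fun e' m hincl => ?_
  -- every summand is the diagonal one
  obtain rfl : e' = fun _ => x₀ := funext fun a => hx (e' a)
  -- the slot-`0` box lies in `p^m·log_p(R^×)`: read its content through abc-iut-c312-5's exact cell, `∀ J` collapsed to `j·d_K`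
  have h0 := (iota_smul_normalizedPacket_subset_zpow_smul_logPacket_iff (ratChar u) ((presAtM D hlog u).kk fun _ => x₀)
    (c := fun _ => cin₀) (fun _ => hin0) (fun _ => hin) (fun _ => hmax) (0 : (thetaIndexOfInitial D).Caps j) _ m).mp
    ((Set.subset_iUnion _ (0 : (thetaIndexOfInitial D).Caps j)).trans hincl)
  have hC : (0 : ℝ) ≤ ∏ _b : (thetaIndexOfInitial D).Caps j, ‖cin₀‖ := Finset.prod_nonneg fun _ _ => norm_nonneg _
  have hinf := (forall_dFac_le_rpow_mul_iff_inf (ratChar u) (fun _ : (thetaIndexOfInitial D).Caps j => (presAtM D hlog u).k x₀)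
    hC).mp h0
  rw [dSum_sub_inf_differentOrd_dFac_const (ratChar u) ((presAtM D hlog u).k x₀), Finset.prod_const, Finset.card_univ,
    Fintype.card_fin] at hinf
  have hcast : ((((j : ℕ) + 1 : ℕ) : ℝ) - 1) = ((j : ℕ) : ℝ) := by push_cast; ring
  rw [hcast] at hinf
  -- in integers: `m·e ≤ M − j·D − (j+1)·R_in`
  have hmInt : m * (e : ℤ) ≤ Mx - ((j : ℕ) : ℤ) * (Dx : ℤ) - (((j : ℕ) : ℤ) + 1) * Rin := by
    have h1 : (ratChar u : ℝ) ^ m * ‖(ϖ : kOfM D (ratChar u) u (natCast_ratChar_mem u) x₀)‖ ^ Mx ≤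
        (ratChar u : ℝ) ^ (-(((j : ℕ) : ℝ) * differentOrd (ratChar u) (kOfM D (ratChar u) u (natCast_ratChar_mem u) x₀))) *
          (‖(ϖ : kOfM D (ratChar u) u (natCast_ratChar_mem u) x₀)‖ ^ Rin) ^ ((j : ℕ) + 1) := by
      rw [← hΘ, ← hRin]; exact hinf
    rw [zpow_mul_norm_zpow_le_iff (ratChar u) hϖ m Mx Rin _ ((j : ℕ) + 1), hD, ← he_def] at h1
    have h2 : -(((j : ℕ) : ℝ) * ((Dx : ℝ) / (e : ℝ))) * (e : ℝ) = -(((j : ℕ) : ℝ) * Dx) := by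
      have heR : (e : ℝ) ≠ 0 := by exact_mod_cast he0.ne'
      field_simp
    rw [h2] at h1
    have h3 : ((m * (e : ℤ) : ℤ) : ℝ) ≤ ((Mx - ((j : ℕ) : ℤ) * (Dx : ℤ) - (((j : ℕ) : ℤ) + 1) * Rin : ℤ) : ℝ) := by
      push_cast at h1 ⊢; linarith
    exact_mod_cast h3
  -- the predicate gives `e·m + (j+1)·R_out ≤ m_q`
  have hheart := (forall_int_mul_le_imp_iff_ediv_orders he0 _ _ _).mpr hpred m hmInt
  -- back to norms at the (unique) summand
  show (ratChar u : ℝ) ^ m * ‖tq u x₀‖ ≤ ∏ _a : (thetaIndexOfInitial D).Caps j, ‖z x₀‖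
  rw [Finset.prod_const, Finset.card_univ, Fintype.card_fin, hz0, hq, hRout]
  have h4 := zpow_mul_norm_zpow_le_iff (ratChar u) hϖ m mq Rout 0 ((j : ℕ) + 1)
  rw [neg_zero, Real.rpow_zero, one_mul, ← he_def] at h4
  refine h4.mpr ?_
  have h5 : (((e : ℤ) * m + (((j : ℕ) : ℤ) + 1) * Rout : ℤ) : ℝ) ≤ ((mq : ℤ) : ℝ) := by exact_mod_cast hheart
  push_cast at h5 ⊢
  linarith

/-! ## §3. All fibres singletons: the licence is the family of orders predicates, EXACTLY -/

/-- **SINGLETON FIBRES EVERYWHERE: THE (xi-f) LICENCE AT THE M SETTING ⟺ THE ORDERS PREDICATES.** Non-zero Θ-ideles; at every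
finite rational place `u` the fibre of `V̲` has one member `x₀(u)` (e.g. `F_mod = ℚ`), with a uniformiser `ϖ_u`, `d = D_u/e_u`, radius
witnesses `‖cin(u)‖ = ‖ϖ_u‖^{R_in(u)}`, `‖cout(u)‖ = ‖ϖ_u‖^{R_out(u)}`, and integer norms `‖t_{Θ,i,x₀(u)}‖ = ‖ϖ_u‖^{M(u,i)}`,
`‖t_{q,x₀(u)}‖ = ‖ϖ_u‖^{m_q(u)}`. THEN `Thm311ToCor312.Licence (settingPrVolSharpM …)` — for the q-pinned reading the branch-C binder S_H on
`𝔽_l^⋇` (abc-iut-w5-d068 `licence_of_pilotKummerCompatHull`) — holds **iff**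
`∀ u i, e_u·((M(u,i) − (i+1)·D_u − (i+2)·R_in(u)) / e_u) + (i+2)·R_out(u) ≤ m_q(u)` (archimedean packets automatic; at members where both
ideles are units the predicate is automatic, `orders_predicate_of_exponents_zero`). [cite: Mochizuki2012, IUTchIII Cor. 3.12 p. 173–174,
Step (xi-f) p. 184; IUTchIV Prop. 1.2 (i)(ii) p. 10] [cite: DupuyHilado2025, §3.4, §4.9, §4.12] -/
theorem licence_settingPrVolSharpM_iff_orders_of_forall_eq (ht0 : ∀ u i x, t u i x ≠ 0)
    (x₀ : ∀ u : FinitePlace ℚ, (thetaIndexOfInitial D).Fibre (Val.non u))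
    (hx : ∀ (u : FinitePlace ℚ) (x : (thetaIndexOfInitial D).Fibre (Val.non u)), x = x₀ u)
    (ϖ : ∀ u : FinitePlace ℚ, (kOfM D (ratChar u) u (natCast_ratChar_mem u) (x₀ u))ˣ) (hϖ : ∀ u, IsUniformizer (ϖ u))
    (Dx : FinitePlace ℚ → ℕ)
    (hD : ∀ u, differentOrd (ratChar u) (kOfM D (ratChar u) u (natCast_ratChar_mem u) (x₀ u)) =
      (Dx u : ℝ) / absRamificationIdx (ratChar u) (kOfM D (ratChar u) u (natCast_ratChar_mem u) (x₀ u)))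
    (cin cout : ∀ u : FinitePlace ℚ, kOfM D (ratChar u) u (natCast_ratChar_mem u) (x₀ u))
    (hin : ∀ u (o : kOfM D (ratChar u) u (natCast_ratChar_mem u) (x₀ u)), ‖o‖ ≤ 1 →
      cin u * o ∈ logUnits (kOfM D (ratChar u) u (natCast_ratChar_mem u) (x₀ u)))
    (hmax : ∀ u, ∃ (ϖ' : (kOfM D (ratChar u) u (natCast_ratChar_mem u) (x₀ u))ˣ)
      (w : kOfM D (ratChar u) u (natCast_ratChar_mem u) (x₀ u)),
      IsUniformizer ϖ' ∧ w ∉ logUnits (kOfM D (ratChar u) u (natCast_ratChar_mem u) (x₀ u)) ∧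
        ‖w‖ * ‖(ϖ' : kOfM D (ratChar u) u (natCast_ratChar_mem u) (x₀ u))‖ ≤ ‖cin u‖)
    (houtΛ : ∀ u, cout u ∈ logUnits (kOfM D (ratChar u) u (natCast_ratChar_mem u) (x₀ u)))
    (hdom : ∀ u, ∀ z ∈ logUnits (kOfM D (ratChar u) u (natCast_ratChar_mem u) (x₀ u)), ‖z‖ ≤ ‖cout u‖)
    (Rin Rout : FinitePlace ℚ → ℤ)
    (hRin : ∀ u, ‖cin u‖ = ‖(ϖ u : kOfM D (ratChar u) u (natCast_ratChar_mem u) (x₀ u))‖ ^ Rin u)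
    (hRout : ∀ u, ‖cout u‖ = ‖(ϖ u : kOfM D (ratChar u) u (natCast_ratChar_mem u) (x₀ u))‖ ^ Rout u)
    (Mx : FinitePlace ℚ → Fin (thetaIndexOfInitial D).lstar → ℤ) (mq : FinitePlace ℚ → ℤ)
    (hΘ : ∀ u i, ‖t u i (x₀ u)‖ = ‖(ϖ u : kOfM D (ratChar u) u (natCast_ratChar_mem u) (x₀ u))‖ ^ Mx u i)
    (hq : ∀ u, ‖tq u (x₀ u)‖ = ‖(ϖ u : kOfM D (ratChar u) u (natCast_ratChar_mem u) (x₀ u))‖ ^ mq u) :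
    Thm311ToCor312.Licence
        (settingPrVolSharpM D hlog t tq M archPk archSub Ψ act Mmod region n lat sig split qData htq0 Sq htq1) ↔
      ∀ (u : FinitePlace ℚ) (i : Fin (thetaIndexOfInitial D).lstar),
        (absRamificationIdx (ratChar u) (kOfM D (ratChar u) u (natCast_ratChar_mem u) (x₀ u)) : ℤ) *
            ((Mx u i - ((i : ℕ) + 1 : ℕ) * (Dx u : ℤ) - ((i : ℕ) + 2 : ℕ) * Rin u) /
              (absRamificationIdx (ratChar u) (kOfM D (ratChar u) u (natCast_ratChar_mem u) (x₀ u)) : ℤ)) +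
          ((i : ℕ) + 2 : ℕ) * Rout u ≤ mq u := by
  refine ⟨fun hL u i => orders_of_licence_settingPrVolSharpM D hlog t tq M archPk archSub Ψ act Mmod region n lat sig split qData
    htq0 Sq htq1 ht0 hL u i (x₀ u) (hϖ u) (hD u) (hin u) (hmax u) (houtΛ u) (hdom u) (hRin u) (hRout u) (hΘ u i) (hq u),
    fun h i vQ => ?_⟩
  rcases vQ with w | u
  · exact qRegion_subset_thetaHull_settingPrVolSharpM_arc D hlog t tq M archPk archSub Ψ act Mmod region n lat sig split qData
      htq0 Sq htq1 _ w
  · have hj : ((Setting.labelSucc i : (thetaIndexOfInitial D).Label) : ℕ) = (i : ℕ) + 1 := by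
      simp [Setting.labelSucc]
    have hΘ' : ‖(presAtM D hlog u).labelIdele (t u) (Setting.labelSucc i) (x₀ u)‖ =
        ‖(ϖ u : kOfM D (ratChar u) u (natCast_ratChar_mem u) (x₀ u))‖ ^ Mx u i := by
      rw [PadicPresentation.labelIdele_labelSucc]; exact hΘ u i
    refine (qRegion_subset_thetaHull_settingPrVolSharpM_iff_orders_of_forall_eq D hlog t tq M archPk archSub Ψ act Mmod region n
      lat sig split qData htq0 Sq htq1 ht0 (Setting.labelSucc i) u (x₀ u) (hx u) (hϖ u) (hD u) (hin u) (hmax u) (houtΛ u)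
      (hdom u) (hRin u) (hRout u) hΘ' (hq u)).mpr ?_
    rw [hj]
    have hc1 : ((((i : ℕ) + 1 : ℕ) : ℤ) + 1) = (((i : ℕ) + 2 : ℕ) : ℤ) := by push_cast; ring
    rw [hc1]
    exact h u i

end Summit.ABC.IUTFork.Thm311.Real

end
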